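import Literature.AnabelianGeometry.SemiGraphs.CoveringOfObject
import Literature.AnabelianGeometry.SemiGraphs.CoveringHomCanonicalEq
import Literature.AnabelianGeometry.SemiGraphs.FiniteEtaleCoveringVertexAligned
import Literature.AnabelianGeometry.Anabelioids.FiniteEtaleLocalDictionaryStabilizer
import Literature.AnabelianGeometry.Anabelioids.ExactFunctorProofs
import Literature.AnabelianGeometry.Anabelioids.FiberFunctorUnique
import HarnessLib

/-!
# The covering `𝒢_A → 𝒢` of an object of `B(𝒢)` is VERTEX-ALIGNED ([SemiAnbd] §2 p. 23, Rem. 2.2.1 p. 24)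

Mochizuki, *Semi-graphs of anabelioids*, Publ. RIMS **42** (2006) 221–322, §2: Definition 2.2 (i) p. 23
builds, from a finite étale object `A` of `B(𝒢)`, the covering `𝒢_A → 𝒢` (tree: `BObj.coveringHom`,
`CoveringOfObject.lean`, abc-iut-L3-t5; canonical twin `BObj.coveringHomCan`, equal to it by
`coveringHomCan_eq_coveringHom`), and Remark 2.2.1 p. 24 records that the image of each verticial
subgroup in `Π_𝒢` is the stabiliser (decomposition group) of a compatible system of vertices
[cite: MochizukiSemiAnbd2006, Rem. 2.2.1 p.24].  abc-iut cell, layer L3, G25 row G10 (W4-14): this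
PROOF-ONLY file (no `def`) discharges L6-d4's predicate `Hom.IsVertexAligned`
(`FiniteEtaleCoveringVertexAligned.lean`) for the constructed covering:

* `BObj.coveringHom_isVertexAligned : A.coveringHom.IsVertexAligned` and the twin
  `BObj.coveringHomCan_isVertexAligned` — for every vertex `v′ = (v, P)` of `𝒢_A` and basepoints
  `F′`, `F`, `e : φ_{v′}^* ⋙ F′ ≅ F`: (a) `ι(Π_{v′}) = Π′ ∩ Π_v`; (b) for every `v″ = (v, P″)` over `v` and
  every transport `α` of basepoints of `B(𝒢_A)`, `ι(conj_α Π_{v″}) = Π′ ∩ g⁻¹ Π_v g` for some `g ∈ Π_𝒢`.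

Method (the source's "stabilizer of a compatible system of vertices", made pointwise): the pull-back
`φ^* A ∈ B(𝒢_A)` carries a DIAGONAL ENDOMORPHISM `d` (`exists_pullbackObj_diagEndo`: vertex part
`(p, s) ↦ (p, p)` on `P × S_v → P`, edge part likewise, compatible with the gluing 2-cells by the core
chase `gluingFunctor_map_diag`), which acts on every fibre as a CONSTANT map (`map_diagEndo_fS_apply`,
through the one-point fibre of the terminal object `P = P` of `(𝒢_v)_{/P}`); hence its value, the
tautological point `a′`, is fixed by all of `Π_{𝒢_A}` ((K) `app_pullbackObj_diagPoint`,
(K′) `range_ι_le_stabilizer`).  The local half is L6-t17's `range_pi1Map_eq_stabilizer`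
(`π₁((𝒢_v)_P) ≤ π₁(𝒢_v)` is a point stabiliser); clause (a) is `coveringHom_vertexAligned_base`,
clause (b) is `coveringHom_vertexAligned_conj` (transport of the tautological point from `v″` to `v′`
by naturality of `α` along `d`, conjugating element from `map_range_pi1Map_autMulEquivOfIso`).
Section A is generic bookkeeping on `Aut` of basepoints (`pi1Map`, conjugation, stabilisers).
`set_option backward.isDefEq.respectTransparency false` is used because `Over.star` unfolds through
`cofree`.  Nothing here bears on [IUTchIII] Cor. 3.12; typed ≠ discharged elsewhere, but THIS row is
discharged (sorry-free, axioms standard).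
-/

namespace Literature.AnabelianGeometry.SemiGraphs

open CategoryTheory CategoryTheory.Limits CategoryTheory.Functor CategoryTheory.PreGaloisCategory
open Literature.AnabelianGeometry.Anabelioids
open scoped Pointwise

universe v₁ u₁ u

/-! ### A. Generic bookkeeping on `Aut` of basepoints -/

section Generic

variable {B : Type*} [Category B] {C : Type*} [Category C]

set_option backward.isDefEq.respectTransparency false

/-- Conjugation by a whiskered isomorphism of basepoints commutes with `pi1Map`:
`conj_{R γ} ∘ π₁(R)_{G₁} = π₁(R)_{G₂} ∘ conj_γ`. [cite: MochizukiGeoAn2004, Def. 1.1.2(ii) p.10] -/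
theorem autMulEquivOfIso_whiskerLeft_pi1Map (R : B ⥤ C) {G₁ G₂ : C ⥤ FintypeCat.{v₁}} (γ : G₁ ≅ G₂)
    (σ : Aut G₁) :
    Aut.autMulEquivOfIso (isoWhiskerLeft R γ) (pi1Map R G₁ σ) =
      pi1Map R G₂ (Aut.autMulEquivOfIso γ σ) :=
  Iso.ext (NatTrans.ext (funext fun _ => rfl))

/-- Components of a conjugated automorphism of a basepoint: `(conj_h x) = h⁻¹ ≫ x ≫ h`.
[cite: MochizukiGeoAn2004, Def. 1.1.2(ii) p.10] -/
theorem autMulEquivOfIso_hom {D : Type*} [Category D] {X Y : D} (h : X ≅ Y) (x : Aut X) :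
    (Aut.autMulEquivOfIso h x).hom = h.inv ≫ x.hom ≫ h.hom := rfl

/-- Composition in `Aut`: `(a * b).hom = b.hom ≫ a.hom`. [cite: MochizukiGeoAn2004, Def. 1.1.2(ii) p.10] -/
theorem aut_mul_hom {D : Type*} [Category D] {X : D} (a b : Aut X) : (a * b).hom = b.hom ≫ a.hom := rfl

/-- Inversion in `Aut`: `(a⁻¹).hom = a.inv`. [cite: MochizukiGeoAn2004, Def. 1.1.2(ii) p.10] -/
theorem aut_inv_hom {D : Type*} [Category D] {X : D} (a : Aut X) : (a⁻¹).hom = a.inv := rfl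

/-- The image of a point stabiliser under `π₁(R)` is the stabiliser of the image point intersected
with the image of `π₁(R)`, for a morphism `m : X ⟶ R A` that the basepoint sends to an injection.
[cite: MochizukiSemiAnbd2006, Rem. 2.2.1 p.24] -/
theorem map_stabilizer_pi1Map_eq (R : B ⥤ C) (G : C ⥤ FintypeCat.{v₁}) {X : C} {A : B}
    (m : X ⟶ R.obj A) (hm : Function.Injective (G.map m)) (p : G.obj X) :
    (MulAction.stabilizer (Aut G) p).map (pi1Map R G) =
      @MulAction.stabilizer (Aut (R ⋙ G)) ((R ⋙ G).obj A) _ _ (G.map m p) ⊓ (pi1Map R G).range := by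
  ext g
  simp only [Subgroup.mem_map, Subgroup.mem_inf, MonoidHom.mem_range, MulAction.mem_stabilizer_iff,
    mulAction_def]
  constructor
  · rintro ⟨h, hh, rfl⟩
    refine ⟨?_, ⟨h, rfl⟩⟩
    change h.hom.app (R.obj A) (G.map m p) = G.map m p
    rw [FunctorToFintypeCat.naturality, hh]
  · rintro ⟨hg, ⟨h, rfl⟩⟩
    refine ⟨h, ?_, rfl⟩
    change h.hom.app (R.obj A) (G.map m p) = G.map m p at hg
    rw [FunctorToFintypeCat.naturality] at hg
    exact hm hg

/-- Conjugation by an isomorphism of basepoints carries point stabilisers to point stabilisers.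
[cite: MochizukiSemiAnbd2006, Rem. 2.2.1 p.24] -/
theorem map_stabilizer_autMulEquivOfIso {G₁ G₂ : C ⥤ FintypeCat.{v₁}} (β : G₁ ≅ G₂) {A : C}
    (x : G₁.obj A) :
    (MulAction.stabilizer (Aut G₁) x).map (Aut.autMulEquivOfIso β).toMonoidHom =
      MulAction.stabilizer (Aut G₂) (β.hom.app A x) := by
  ext g
  simp only [Subgroup.mem_map, MulAction.mem_stabilizer_iff, mulAction_def, MulEquiv.coe_toMonoidHom]
  constructor
  · rintro ⟨h, hh, rfl⟩
    change (β.inv ≫ h.hom ≫ β.hom).app A (β.hom.app A x) = β.hom.app A x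
    rw [NatTrans.comp_app, NatTrans.comp_app, FintypeCat.comp_apply, FintypeCat.comp_apply,
      ← FintypeCat.comp_apply (β.hom.app A) (β.inv.app A), Iso.hom_inv_id_app, FintypeCat.id_apply, hh]
  · intro hg
    refine ⟨(Aut.autMulEquivOfIso β).symm g, ?_, (Aut.autMulEquivOfIso β).apply_symm_apply g⟩
    change (β.hom ≫ g.hom ≫ β.inv).app A x = x
    rw [NatTrans.comp_app, NatTrans.comp_app, FintypeCat.comp_apply, FintypeCat.comp_apply, hg,
      ← FintypeCat.comp_apply (β.hom.app A) (β.inv.app A), Iso.hom_inv_id_app, FintypeCat.id_apply]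

/-- Conjugation by an isomorphism of basepoints carries the range of `π₁(R)` at one basepoint to a
CONJUGATE of its range at another: if `γ : G₁ ≅ G₂` is an isomorphism of basepoints of `C` and
`β : R ⋙ G₁ ≅ R ⋙ G₂` any isomorphism of the induced basepoints, then
`conj_β(range π₁(R)_{G₁}) = g⁻¹ (range π₁(R)_{G₂}) g` for `g := (R γ)⁻¹ β ∈ Aut (R ⋙ G₂)`.
[cite: MochizukiSemiAnbd2006, Rem. 2.2.1 p.24] -/
theorem map_range_pi1Map_autMulEquivOfIso (R : B ⥤ C) {G₁ G₂ : C ⥤ FintypeCat.{v₁}} (γ : G₁ ≅ G₂)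
    (β : R ⋙ G₁ ≅ R ⋙ G₂) :
    ∃ g : Aut (R ⋙ G₂), (pi1Map R G₁).range.map (Aut.autMulEquivOfIso β).toMonoidHom =
      ConjAct.toConjAct g⁻¹ • (pi1Map R G₂).range := by
  -- `g := β⁻¹ ≫ R γ` as an automorphism of `R ⋙ G₂`
  set g : Aut (R ⋙ G₂) := β.symm ≪≫ isoWhiskerLeft R γ with hg
  refine ⟨g, ?_⟩
  -- conjugation by `β` = conjugation by `R γ` followed by conjugation by `g⁻¹`
  have key' : ∀ x : Aut (R ⋙ G₁), Aut.autMulEquivOfIso β x =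
      g⁻¹ * Aut.autMulEquivOfIso (isoWhiskerLeft R γ) x * g⁻¹⁻¹ := by
    intro x
    apply Iso.ext
    rw [inv_inv, autMulEquivOfIso_hom, aut_mul_hom, aut_mul_hom, aut_inv_hom, autMulEquivOfIso_hom, hg]
    simp only [Iso.trans_hom, Iso.trans_inv, Iso.symm_hom, Iso.symm_inv, Category.assoc,
      Iso.hom_inv_id_assoc]
  have key : ∀ z : Aut G₁, Aut.autMulEquivOfIso β (pi1Map R G₁ z) =
      g⁻¹ * pi1Map R G₂ (Aut.autMulEquivOfIso γ z) * g⁻¹⁻¹ := by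
    intro z
    rw [key', autMulEquivOfIso_whiskerLeft_pi1Map]
  ext y
  simp only [Subgroup.mem_map, MonoidHom.mem_range, MulEquiv.coe_toMonoidHom,
    Subgroup.mem_smul_pointwise_iff_exists, ConjAct.smul_def, ConjAct.ofConjAct_toConjAct,
    exists_exists_eq_and]
  constructor
  · rintro ⟨z, rfl⟩
    exact ⟨Aut.autMulEquivOfIso γ z, (key z).symm⟩
  · rintro ⟨w, rfl⟩
    refine ⟨(Aut.autMulEquivOfIso γ).symm w, ?_⟩
    rw [key, MulEquiv.apply_symm_apply]

/-- Conjugation by a composite isomorphism. [cite: MochizukiGeoAn2004, Def. 1.1.2(ii) p.10] -/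
theorem autMulEquivOfIso_trans {D : Type*} [Category D] {X Y Z : D} (a : X ≅ Y) (b : Y ≅ Z) (y : Aut X) :
    Aut.autMulEquivOfIso (a ≪≫ b) y = Aut.autMulEquivOfIso b (Aut.autMulEquivOfIso a y) := by
  apply Iso.ext
  simp only [autMulEquivOfIso_hom, Iso.trans_hom, Iso.trans_inv, Category.assoc]

/-- Conjugation by the identity isomorphism. [cite: MochizukiGeoAn2004, Def. 1.1.2(ii) p.10] -/
theorem autMulEquivOfIso_refl {D : Type*} [Category D] {X : D} (y : Aut X) :
    Aut.autMulEquivOfIso (Iso.refl X) y = y := by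
  apply Iso.ext
  simp only [autMulEquivOfIso_hom, Iso.refl_hom, Iso.refl_inv, Category.id_comp, Category.comp_id]

/-- For a morphism `m : U ⟶ X × Y → X` over `X`, the first component of `m` is the structure map
of `U` (the `Over.w` of `m`, with the structure map of `Over.star X Y` identified with `prod.fst`).
[cite: MochizukiSemiAnbd2006, Def. 2.2(i) p.23] -/
theorem left_comp_prod_fst [HasBinaryProducts C] {X Y : C} {U : Over X}
    (m : U ⟶ (Over.star X).obj Y) : m.left ≫ (prod.fst : X ⨯ Y ⟶ X) = U.hom := by
  have h := Over.w m
  change m.left ≫ (prod.lift prod.fst (𝟙 _) ≫ prod.fst) = U.hom at h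
  rwa [prod.lift_fst] at h

end Generic


/-! ### B. The diagonal endomorphism of `φ^* A` in `B(𝒢_A)` -/

namespace SemiGraphOfAnabelioids

namespace BObj

variable {𝒢 : SemiGraphOfAnabelioids.{v₁, u₁, u}} (A : 𝒢.BObj)

set_option backward.isDefEq.respectTransparency false

/-- CORE DIAGRAM CHASE (in `(𝒢_e)_{/Q}`): the pull-back `X ↦ b^* X ×_{b^* P} Q` of the diagonal
idempotent `(p, s) ↦ (p, p)` of `P × S_v → P`, followed by the 2-cell `gluingStarIso` and `Q × ψ_b`,
is the 2-cell followed by the diagonal idempotent `(q, t) ↦ (q, q)` of `Q × T_e → Q` — because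
`Q ↪ b^* P ↪ b^* S_v ⥲ T_e` is the inclusion of `Q` (`inclOfLE_comp`).
[cite: MochizukiSemiAnbd2006, Def. 2.2(i) p.23] -/
theorem gluingFunctor_map_diag {b : 𝒢.graph.Branch} {v : 𝒢.graph.Vertex}
    (h₀ : 𝒢.graph.abuts b = some v) (P : Subobject (A.S v))
    (Q : Subobject (A.T (𝒢.graph.edgeOf b))) (hle : Q ≤ A.branchImage b v h₀ P) :
    (A.gluingFunctor h₀ P Q hle).map
        (Over.homMk (prod.lift prod.fst (prod.fst ≫ P.arrow)) (by
            change prod.lift prod.fst (prod.fst ≫ P.arrow) ≫ (prod.lift prod.fst (𝟙 _) ≫ prod.fst) =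
              prod.lift prod.fst (𝟙 _) ≫ prod.fst
            rw [prod.lift_fst, prod.lift_fst]) :
          (Over.star (P : 𝒢.V v)).obj (A.S v) ⟶ (Over.star (P : 𝒢.V v)).obj (A.S v)) ≫
      (A.gluingStarIso h₀ P Q hle).hom.app (A.S v) ≫
        (Over.star (Q : 𝒢.E (𝒢.graph.edgeOf b))).map (A.ψ b v h₀).hom =
    (A.gluingStarIso h₀ P Q hle).hom.app (A.S v) ≫
      (Over.star (Q : 𝒢.E (𝒢.graph.edgeOf b))).map (A.ψ b v h₀).hom ≫
        (Over.homMk (prod.lift prod.fst (prod.fst ≫ Q.arrow)) (by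
            change prod.lift prod.fst (prod.fst ≫ Q.arrow) ≫ (prod.lift prod.fst (𝟙 _) ≫ prod.fst) =
              prod.lift prod.fst (𝟙 _) ≫ prod.fst
            rw [prod.lift_fst, prod.lift_fst]) :
          (Over.star (Q : 𝒢.E (𝒢.graph.edgeOf b))).obj (A.T (𝒢.graph.edgeOf b)) ⟶
            (Over.star (Q : 𝒢.E (𝒢.graph.edgeOf b))).obj (A.T (𝒢.graph.edgeOf b))) := by
  haveI : PreservesFiniteLimits (𝒢.pull b v h₀).pullback := (𝒢.pull b v h₀).property.1
  apply Over.OverMorphism.ext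
  apply Limits.prod.hom_ext
  · -- first components: both are morphisms over `Q`
    rw [left_comp_prod_fst, left_comp_prod_fst]
  · simp only [Over.comp_left, Category.assoc]
    simp only [BObj.gluingStarIso, Functor.comp_map, Over.pullback_map_left, Over.post_map,
      starPostIso_hom_app_left, Iso.trans_hom, NatTrans.comp_app, Over.comp_left, isoWhiskerRight_hom,
      isoWhiskerLeft_hom, whiskerRight_app, whiskerLeft_app, Over.homMk_left, Category.assoc,
      Over.starPullbackIsoStar_hom_app_left, Iso.trans_hom, prod.lift_snd]
    simp only [Over.star_map_left, prod.map_snd, prod.map_fst_assoc]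
    simp only [pullbackProdFstIsoProd_hom_snd_assoc, pullbackProdFstIsoProd_hom_fst_assoc,
      pullbackSymmetry_hom_comp_snd_assoc, pullbackSymmetry_hom_comp_fst_assoc,
      pullback.lift_fst_assoc, pullback.lift_snd_assoc, Category.id_comp, Category.comp_id]
    erw [pullback.lift_fst_assoc, pullback.lift_snd_assoc]
    simp only [Category.assoc]
    erw [pullback.lift_fst_assoc, prodComparison_snd_assoc]
    -- LHS: `fst ≫ b^*(p,s ↦ p,arrow p) ≫ b^* snd ≫ ψ`; RHS: `snd ≫ (Q ↪ T_e)`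
    rw [Category.assoc, ← Functor.map_comp_assoc, prod.lift_snd, Functor.map_comp_assoc]
    have hhom : ((Over.post (𝒢.pull b v h₀).pullback).obj
        ((Over.star (P : 𝒢.V v)).obj (A.S v))).hom = (𝒢.pull b v h₀).pullback.map prod.fst := by
      change (𝒢.pull b v h₀).pullback.map (prod.lift prod.fst (𝟙 _) ≫ prod.fst) = _
      rw [prod.lift_fst]
    rw [← hhom, pullback.condition_assoc]
    conv_rhs => rw [← A.inclOfLE_comp h₀ P Q hle]
    rfl

/-- **The diagonal endomorphism of `φ^* A` in `B(𝒢_A)`** (`φ : 𝒢_A → 𝒢` the covering attached to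
`A`): at the vertex `(v, P)` it is `(p, s) ↦ (p, p)` on `P × S_v → P`, at the edge `(e, Q)` it is
`(q, t) ↦ (q, q)` on `Q × T_e → Q` (through the `Shrink` models); compatibility with the gluing
isomorphisms of `φ^* A` is `gluingFunctor_map_diag`.  Stated as an existence (no data is introduced):
there is an endomorphism of `φ^* A` whose vertex components are these diagonal idempotents.
[cite: MochizukiSemiAnbd2006, Def. 2.2(i) p.23] -/
theorem exists_pullbackObj_diagEndo :
    ∃ d : A.coveringHom.pullbackFunctor.obj A ⟶ A.coveringHom.pullbackFunctor.obj A,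
      ∀ vc : A.fibreData.total.Vertex,
        d.fS vc = (Shrink.equivalence
            (Over ((A.vComp vc).1 : 𝒢.V (A.fibreData.proj.vertexMap vc)))).functor.map
          (Over.homMk (prod.lift prod.fst (prod.fst ≫ (A.vComp vc).1.arrow)) (by
              change prod.lift prod.fst (prod.fst ≫ _) ≫ (prod.lift prod.fst (𝟙 _) ≫ prod.fst) =
                prod.lift prod.fst (𝟙 _) ≫ prod.fst
              rw [prod.lift_fst, prod.lift_fst]) :
            (Over.star ((A.vComp vc).1 : 𝒢.V (A.fibreData.proj.vertexMap vc))).obj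
                (A.S (A.fibreData.proj.vertexMap vc)) ⟶
              (Over.star ((A.vComp vc).1 : 𝒢.V (A.fibreData.proj.vertexMap vc))).obj
                (A.S (A.fibreData.proj.vertexMap vc))) := by
  let δS : ∀ vc : A.fibreData.total.Vertex,
      (Over.star ((A.vComp vc).1 : 𝒢.V (A.fibreData.proj.vertexMap vc))).obj
          (A.S (A.fibreData.proj.vertexMap vc)) ⟶
        (Over.star ((A.vComp vc).1 : 𝒢.V (A.fibreData.proj.vertexMap vc))).obj
          (A.S (A.fibreData.proj.vertexMap vc)) :=
    fun vc => Over.homMk (prod.lift prod.fst (prod.fst ≫ (A.vComp vc).1.arrow)) (by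
      change prod.lift prod.fst (prod.fst ≫ _) ≫ (prod.lift prod.fst (𝟙 _) ≫ prod.fst) =
        prod.lift prod.fst (𝟙 _) ≫ prod.fst
      rw [prod.lift_fst, prod.lift_fst])
  let δT : ∀ ec : A.fibreData.total.Edge,
      (Over.star ((A.eComp ec).1 : 𝒢.E (A.fibreData.proj.edgeMap ec))).obj
          (A.T (A.fibreData.proj.edgeMap ec)) ⟶
        (Over.star ((A.eComp ec).1 : 𝒢.E (A.fibreData.proj.edgeMap ec))).obj
          (A.T (A.fibreData.proj.edgeMap ec)) :=
    fun ec => Over.homMk (prod.lift prod.fst (prod.fst ≫ (A.eComp ec).1.arrow)) (by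
      change prod.lift prod.fst (prod.fst ≫ _) ≫ (prod.lift prod.fst (𝟙 _) ≫ prod.fst) =
        prod.lift prod.fst (𝟙 _) ≫ prod.fst
      rw [prod.lift_fst, prod.lift_fst])
  refine ⟨⟨fun vc => (Shrink.equivalence
      (Over ((A.vComp vc).1 : 𝒢.V (A.fibreData.proj.vertexMap vc)))).functor.map (δS vc),
    fun ec => (Shrink.equivalence
      (Over ((A.eComp ec).1 : 𝒢.E (A.fibreData.proj.edgeMap ec)))).functor.map (δT ec), ?_⟩,
    fun vc => rfl⟩
  intro bc vc h
  -- names for the data at the branch `(b, Q)` abutting to `(v, P)`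
  let v := A.fibreData.proj.vertexMap vc
  let b := A.fibreData.proj.branchMap bc
  have h₀ : 𝒢.graph.abuts b = some v := abuts_fst h
  let P : Subobject (A.S v) := (A.vComp vc).1
  let Q : Subobject (A.T (𝒢.graph.edgeOf b)) := (A.brComp bc).1
  have hle : Q ≤ A.branchImage b v h₀ P := brComp_le_branchImage h
  let eP := Shrink.equivalence (Over (P : 𝒢.V v))
  let eQ := Shrink.equivalence (Over (Q : 𝒢.E (𝒢.graph.edgeOf b)))
  let G := A.gluingFunctor h₀ P Q hle
  have hψ₁ : ((A.coveringHom.pullbackFunctor.obj A).ψ bc vc h).hom =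
      (A.coveringHom.φB bc vc h).hom.app (A.S v) ≫
        (A.coveringHom.φE _ _ (A.fibreData.proj.edgeOf_branchMap bc).symm).pullback.map
          (A.ψ b v (A.fibreData.proj.abuts_branchMap bc vc h)).hom ≫
        (A.coveringHom.reindexIso (A.fibreData.total.edgeOf bc) _ _
          (A.fibreData.proj.edgeOf_branchMap bc).symm rfl).hom.app A := rfl
  have hψ₂ : (A.coveringHom.reindexIso (A.fibreData.total.edgeOf bc) _ _
          (A.fibreData.proj.edgeOf_branchMap bc).symm rfl).hom.app A = 𝟙 _ := by
    simp [Hom.reindexIso]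
  have hψ₃ : (A.coveringHom.φB bc vc h).hom.app (A.S v) =
      eQ.functor.map (G.map (eP.unitIso.inv.app ((Over.star (P : 𝒢.V v)).obj (A.S v)))) ≫
        eQ.functor.map ((A.gluingStarIso h₀ P Q hle).hom.app (A.S v)) := rfl
  have hψ₄ : (A.coveringHom.φE _ _ (A.fibreData.proj.edgeOf_branchMap bc).symm).pullback.map
          (A.ψ b v (A.fibreData.proj.abuts_branchMap bc vc h)).hom =
      eQ.functor.map ((Over.star (Q : 𝒢.E (𝒢.graph.edgeOf b))).map (A.ψ b v h₀).hom) := rfl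
  have hpull : (A.coveringGraph.pull bc vc h).pullback.map
        ((Shrink.equivalence (Over (Subobject.underlying.obj (A.vComp vc).1))).functor.map (δS vc)) =
      eQ.functor.map (G.map (eP.inverse.map (eP.functor.map (δS vc)))) := rfl
  have hT : (Shrink.equivalence (Over (Subobject.underlying.obj
          (A.eComp (A.coveringGraph.graph.edgeOf bc)).1))).functor.map (δT (A.coveringGraph.graph.edgeOf bc)) =
      eQ.functor.map (Over.homMk (prod.lift prod.fst (prod.fst ≫ Q.arrow)) (by
        change prod.lift prod.fst (prod.fst ≫ _) ≫ (prod.lift prod.fst (𝟙 _) ≫ prod.fst) =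
          prod.lift prod.fst (𝟙 _) ≫ prod.fst
        rw [prod.lift_fst, prod.lift_fst]) :
          (Over.star (Q : 𝒢.E (𝒢.graph.edgeOf b))).obj (A.T (𝒢.graph.edgeOf b)) ⟶
            (Over.star (Q : 𝒢.E (𝒢.graph.edgeOf b))).obj (A.T (𝒢.graph.edgeOf b))) := rfl
  -- unit naturality and the core chase, in `(𝒢_e)_{/Q}`
  have nat : eP.inverse.map (eP.functor.map (δS vc)) ≫
        eP.unitIso.inv.app ((Over.star (P : 𝒢.V v)).obj (A.S v)) =
      eP.unitIso.inv.app ((Over.star (P : 𝒢.V v)).obj (A.S v)) ≫ δS vc :=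
    eP.unitIso.inv.naturality (δS vc)
  have core : G.map (δS vc) ≫ (A.gluingStarIso h₀ P Q hle).hom.app (A.S v) ≫
        (Over.star (Q : 𝒢.E (𝒢.graph.edgeOf b))).map (A.ψ b v h₀).hom =
      (A.gluingStarIso h₀ P Q hle).hom.app (A.S v) ≫
        (Over.star (Q : 𝒢.E (𝒢.graph.edgeOf b))).map (A.ψ b v h₀).hom ≫
          (Over.homMk (prod.lift prod.fst (prod.fst ≫ Q.arrow)) (by
            change prod.lift prod.fst (prod.fst ≫ _) ≫ (prod.lift prod.fst (𝟙 _) ≫ prod.fst) =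
              prod.lift prod.fst (𝟙 _) ≫ prod.fst
            rw [prod.lift_fst, prod.lift_fst]) :
          (Over.star (Q : 𝒢.E (𝒢.graph.edgeOf b))).obj (A.T (𝒢.graph.edgeOf b)) ⟶
            (Over.star (Q : 𝒢.E (𝒢.graph.edgeOf b))).obj (A.T (𝒢.graph.edgeOf b))) :=
    A.gluingFunctor_map_diag h₀ P Q hle
  rw [hpull, hψ₁, hψ₂, hψ₃, hψ₄, hT]
  erw [Category.comp_id]
  simp only [Category.assoc, ← Functor.map_comp]
  congr 1
  rw [← G.map_comp_assoc, nat, G.map_comp_assoc, core]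

/-! ### C. The tautological point of `φ^* A` is fixed by `Π_{𝒢_A}` -/

/-- The one-point fibre `F′(P = P)` (terminal object of `(𝒢_v)_{/P}`, in the model) is inhabited.
[cite: MochizukiSemiAnbd2006, Rem. 2.2.1 p.24] -/
theorem nonempty_fiber_mkId (v' : A.fibreData.total.Vertex)
    (F' : A.coveringGraph.V v' ⥤ FintypeCat.{v₁}) [FiberFunctor F'] :
    Nonempty (F'.obj ((Shrink.equivalence (Over ((A.vComp v').1 : 𝒢.V (A.fibreData.proj.vertexMap v')))).functor.obj
      (Over.mk (𝟙 ((A.vComp v').1 : 𝒢.V (A.fibreData.proj.vertexMap v')))))) := by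
  haveI : GaloisCategory (Shrink.{u₁} (Over ((A.vComp v').1 : 𝒢.V (A.fibreData.proj.vertexMap v')))) :=
    A.galoisCategory_vModel v'
  have hT := Over.mkIdTerminal.isTerminalObj
    (Shrink.equivalence (Over ((A.vComp v').1 : 𝒢.V (A.fibreData.proj.vertexMap v')))).functor
    (Over.mk (𝟙 ((A.vComp v').1 : 𝒢.V (A.fibreData.proj.vertexMap v'))))
  obtain ⟨eqv⟩ := nonempty_equiv_fiber_terminal_punit F'
  exact ⟨F'.map (hT.uniqueUpToIso terminalIsTerminal).inv (eqv.symm PUnit.unit)⟩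

/-- **The diagonal endomorphism acts on fibres as a CONSTANT map** with value the diagonal point
`a′ = F′((p ↦ (p, p)) : (P = P) → (P × S_v → P))(t)`: the idempotent `(p, s) ↦ (p, p)` factors through
the terminal object `P = P` of `(𝒢_v)_{/P}`, whose fibre is a single point.
[cite: MochizukiSemiAnbd2006, Rem. 2.2.1 p.24] -/
theorem map_diagEndo_fS_apply
    (d : A.coveringHom.pullbackFunctor.obj A ⟶ A.coveringHom.pullbackFunctor.obj A)
    (hd : ∀ vc : A.fibreData.total.Vertex,
        d.fS vc = (Shrink.equivalence
            (Over ((A.vComp vc).1 : 𝒢.V (A.fibreData.proj.vertexMap vc)))).functor.map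
          (Over.homMk (prod.lift prod.fst (prod.fst ≫ (A.vComp vc).1.arrow)) (by
              change prod.lift prod.fst (prod.fst ≫ _) ≫ (prod.lift prod.fst (𝟙 _) ≫ prod.fst) =
                prod.lift prod.fst (𝟙 _) ≫ prod.fst
              rw [prod.lift_fst, prod.lift_fst]) :
            (Over.star ((A.vComp vc).1 : 𝒢.V (A.fibreData.proj.vertexMap vc))).obj
                (A.S (A.fibreData.proj.vertexMap vc)) ⟶
              (Over.star ((A.vComp vc).1 : 𝒢.V (A.fibreData.proj.vertexMap vc))).obj
                (A.S (A.fibreData.proj.vertexMap vc))))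
    (v' : A.fibreData.total.Vertex) (F' : A.coveringGraph.V v' ⥤ FintypeCat.{v₁}) [FiberFunctor F']
    (t : F'.obj ((Shrink.equivalence (Over ((A.vComp v').1 : 𝒢.V (A.fibreData.proj.vertexMap v')))).functor.obj
      (Over.mk (𝟙 ((A.vComp v').1 : 𝒢.V (A.fibreData.proj.vertexMap v'))))))
    (z : F'.obj ((A.coveringHom.pullbackFunctor.obj A).S v')) :
    F'.map (d.fS v') z =
      F'.map ((Shrink.equivalence (Over ((A.vComp v').1 : 𝒢.V (A.fibreData.proj.vertexMap v')))).functor.map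
          ((Over.forgetAdjStar ((A.vComp v').1 : 𝒢.V (A.fibreData.proj.vertexMap v'))).unit.app (Over.mk (𝟙 _)) ≫
            (Over.star ((A.vComp v').1 : 𝒢.V (A.fibreData.proj.vertexMap v'))).map (A.vComp v').1.arrow)) t := by
  -- notation
  let v := A.fibreData.proj.vertexMap v'
  let P : Subobject (A.S v) := (A.vComp v').1
  let eP := Shrink.equivalence (Over (P : 𝒢.V v))
  let η : Over.mk (𝟙 (P : 𝒢.V v)) ⟶ (Over.star (P : 𝒢.V v)).obj (P : 𝒢.V v) :=
    (Over.forgetAdjStar (P : 𝒢.V v)).unit.app (Over.mk (𝟙 _))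
  let τ : (Over.star (P : 𝒢.V v)).obj (A.S v) ⟶ Over.mk (𝟙 (P : 𝒢.V v)) :=
    Over.homMk prod.fst (by
      change prod.fst ≫ 𝟙 _ = prod.lift prod.fst (𝟙 _) ≫ prod.fst
      rw [prod.lift_fst, Category.comp_id])
  -- the diagonal idempotent factors through the terminal object `P = P` of `(𝒢_v)_{/P}`
  have hδ : (Over.homMk (prod.lift prod.fst (prod.fst ≫ P.arrow)) (by
          change prod.lift prod.fst (prod.fst ≫ _) ≫ (prod.lift prod.fst (𝟙 _) ≫ prod.fst) =
            prod.lift prod.fst (𝟙 _) ≫ prod.fst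
          rw [prod.lift_fst, prod.lift_fst]) :
        (Over.star (P : 𝒢.V v)).obj (A.S v) ⟶ (Over.star (P : 𝒢.V v)).obj (A.S v)) =
      τ ≫ η ≫ (Over.star (P : 𝒢.V v)).map P.arrow := by
    apply Over.OverMorphism.ext
    apply Limits.prod.hom_ext
    · simp [τ, η]
      erw [Category.comp_id]
    · simp [τ, η]
  haveI : GaloisCategory (Shrink.{u₁} (Over (P : 𝒢.V v))) := A.galoisCategory_vModel v'
  haveI : Subsingleton (F'.obj (eP.functor.obj (Over.mk (𝟙 (P : 𝒢.V v))))) :=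
    subsingleton_fiber_mkId eP.functor F'
  rw [hd v', hδ, Functor.map_comp, Functor.map_comp, FintypeCat.comp_apply]
  exact congrArg _ (Subsingleton.elim _ _)

/-- **(K) The tautological point is `Π_{𝒢_A}`-invariant.**  For a vertex `v′ = (v, P)` of `𝒢_A` and a
basepoint `F′` of `(𝒢_v)_P`, every automorphism of the basepoint `ρ′_{v′} ⋙ F′` of `B(𝒢_A)` fixes the
point `a′ ∈ F′((φ^* A)_{v′}) = F′(P × S_v → P)` cut out by the diagonal section
`(p ↦ (p, p)) : (P = P) ⟶ (P × S_v → P)` applied to the point `t` of the one-point fibre `F′(P = P)`: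
the diagonal endomorphism of `φ^* A` (`exists_pullbackObj_diagEndo`) acts on the fibre as the
CONSTANT map with value `a′`, and commutes with the automorphism.
[cite: MochizukiSemiAnbd2006, Rem. 2.2.1 p.24] -/
theorem app_pullbackObj_diagPoint (v' : A.fibreData.total.Vertex)
    (F' : A.coveringGraph.V v' ⥤ FintypeCat.{v₁}) [FiberFunctor F']
    (t : F'.obj ((Shrink.equivalence (Over ((A.vComp v').1 : 𝒢.V (A.fibreData.proj.vertexMap v')))).functor.obj
      (Over.mk (𝟙 ((A.vComp v').1 : 𝒢.V (A.fibreData.proj.vertexMap v'))))))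
    (x : Aut (A.coveringGraph.ρ v' ⋙ F')) :
    x.hom.app (A.coveringHom.pullbackFunctor.obj A)
        (F'.map ((Shrink.equivalence (Over ((A.vComp v').1 : 𝒢.V (A.fibreData.proj.vertexMap v')))).functor.map
          ((Over.forgetAdjStar ((A.vComp v').1 : 𝒢.V (A.fibreData.proj.vertexMap v'))).unit.app (Over.mk (𝟙 _)) ≫
            (Over.star ((A.vComp v').1 : 𝒢.V (A.fibreData.proj.vertexMap v'))).map (A.vComp v').1.arrow)) t) =
      F'.map ((Shrink.equivalence (Over ((A.vComp v').1 : 𝒢.V (A.fibreData.proj.vertexMap v')))).functor.map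
          ((Over.forgetAdjStar ((A.vComp v').1 : 𝒢.V (A.fibreData.proj.vertexMap v'))).unit.app (Over.mk (𝟙 _)) ≫
            (Over.star ((A.vComp v').1 : 𝒢.V (A.fibreData.proj.vertexMap v'))).map (A.vComp v').1.arrow)) t := by
  obtain ⟨d, hd⟩ := A.exists_pullbackObj_diagEndo
  have hnat := FunctorToFintypeCat.naturality (A.coveringGraph.ρ v' ⋙ F') (A.coveringGraph.ρ v' ⋙ F')
    x.hom d (F'.map ((Shrink.equivalence (Over ((A.vComp v').1 : 𝒢.V (A.fibreData.proj.vertexMap v')))).functor.map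
          ((Over.forgetAdjStar ((A.vComp v').1 : 𝒢.V (A.fibreData.proj.vertexMap v'))).unit.app (Over.mk (𝟙 _)) ≫
            (Over.star ((A.vComp v').1 : 𝒢.V (A.fibreData.proj.vertexMap v'))).map (A.vComp v').1.arrow)) t)
  change x.hom.app (A.coveringHom.pullbackFunctor.obj A) (F'.map (d.fS v') _) =
    F'.map (d.fS v') (x.hom.app (A.coveringHom.pullbackFunctor.obj A) _) at hnat
  rw [A.map_diagEndo_fS_apply d hd v' F' t, A.map_diagEndo_fS_apply d hd v' F' t] at hnat
  exact hnat

/-- **(K′) `Π′ = ι(Π_{𝒢_A})` fixes the tautological point `a = e(a′) ∈ F(S_v)`** of the basepoint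
`ρ_v ⋙ F` of `B(𝒢)`, where `ι = conj_{ρ_v e} ∘ π₁(φ^*)`. [cite: MochizukiSemiAnbd2006, Rem. 2.2.1 p.24] -/
theorem range_ι_le_stabilizer (v' : A.fibreData.total.Vertex)
    (F' : A.coveringGraph.V v' ⥤ FintypeCat.{v₁}) [FiberFunctor F']
    (F : 𝒢.V (A.fibreData.proj.vertexMap v') ⥤ FintypeCat.{v₁})
    (e : (A.coveringHom.φV v').pullback ⋙ F' ≅ F)
    (t : F'.obj ((Shrink.equivalence (Over ((A.vComp v').1 : 𝒢.V (A.fibreData.proj.vertexMap v')))).functor.obj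
      (Over.mk (𝟙 ((A.vComp v').1 : 𝒢.V (A.fibreData.proj.vertexMap v')))))) :
    ((Aut.autMulEquivOfIso (isoWhiskerLeft (𝒢.ρ (A.fibreData.proj.vertexMap v')) e)).toMonoidHom.comp
        (pi1Map A.coveringHom.pullbackFunctor (A.coveringGraph.ρ v' ⋙ F'))).range ≤
      @MulAction.stabilizer (Aut (𝒢.ρ (A.fibreData.proj.vertexMap v') ⋙ F))
        ((𝒢.ρ (A.fibreData.proj.vertexMap v') ⋙ F).obj A) _ _
        (e.hom.app (A.S (A.fibreData.proj.vertexMap v'))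
          (F'.map ((Shrink.equivalence (Over ((A.vComp v').1 : 𝒢.V (A.fibreData.proj.vertexMap v')))).functor.map
            ((Over.forgetAdjStar ((A.vComp v').1 : 𝒢.V (A.fibreData.proj.vertexMap v'))).unit.app (Over.mk (𝟙 _)) ≫
              (Over.star ((A.vComp v').1 : 𝒢.V (A.fibreData.proj.vertexMap v'))).map (A.vComp v').1.arrow)) t)) := by
  rintro _ ⟨x, rfl⟩
  refine MulAction.mem_stabilizer_iff.mpr ?_
  have hK := A.app_pullbackObj_diagPoint v' F' t x
  have hinv := FintypeCat.hom_inv_id_apply (e.app (A.S (A.fibreData.proj.vertexMap v')))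
    (F'.map ((Shrink.equivalence (Over ((A.vComp v').1 : 𝒢.V (A.fibreData.proj.vertexMap v')))).functor.map
      ((Over.forgetAdjStar ((A.vComp v').1 : 𝒢.V (A.fibreData.proj.vertexMap v'))).unit.app (Over.mk (𝟙 _)) ≫
        (Over.star ((A.vComp v').1 : 𝒢.V (A.fibreData.proj.vertexMap v'))).map (A.vComp v').1.arrow)) t)
  change (e.inv.app _ ≫ x.hom.app (A.coveringHom.pullbackFunctor.obj A) ≫ e.hom.app _) (e.hom.app _ _) =
    e.hom.app _ _
  rw [FintypeCat.comp_apply, FintypeCat.comp_apply]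
  erw [hinv]
  exact congrArg (e.hom.app _) hK

/-! ### D. Vertex alignment, clause (a): `ι(Π_{v′}) = Π′ ∩ Π_v` -/

/-- The square `Π_{v′} → Π_{𝒢_A} → Π_𝒢` = `Π_{v′} → Π_v → Π_𝒢` for the covering `𝒢_A → 𝒢`, at the level of
homomorphisms of automorphism groups of basepoints (`φ^* ⋙ ρ′_{v′} = ρ_v ⋙ φ_{v′}^*` definitionally).
[cite: MochizukiSemiAnbd2006, Rem. 2.2.1 p.24] -/
theorem ι_comp_piVToPi_eq (v' : A.fibreData.total.Vertex)
    (F' : A.coveringGraph.V v' ⥤ FintypeCat.{v₁})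
    (F : 𝒢.V (A.fibreData.proj.vertexMap v') ⥤ FintypeCat.{v₁})
    (e : (A.coveringHom.φV v').pullback ⋙ F' ≅ F) :
    ((Aut.autMulEquivOfIso (isoWhiskerLeft (𝒢.ρ (A.fibreData.proj.vertexMap v')) e)).toMonoidHom.comp
        (pi1Map A.coveringHom.pullbackFunctor (A.coveringGraph.ρ v' ⋙ F'))).comp
      (A.coveringGraph.piVToPi v' F') =
    (𝒢.piVToPi (A.fibreData.proj.vertexMap v') F).comp
      ((Aut.autMulEquivOfIso e).toMonoidHom.comp (pi1Map (A.coveringHom.φV v').pullback F')) := by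
  refine MonoidHom.ext fun x => Iso.ext (NatTrans.ext (funext fun X => ?_))
  rfl

/-- The base point of L6-t17's stabiliser lemma, for the vertex component of `𝒢_A → 𝒢`, is carried by
`F(P ↪ S_v)` to the tautological point `a = e(a′)`. [cite: MochizukiSemiAnbd2006, Rem. 2.2.1 p.24] -/
theorem map_arrow_basePoint (v' : A.fibreData.total.Vertex)
    (F' : A.coveringGraph.V v' ⥤ FintypeCat.{v₁})
    (F : 𝒢.V (A.fibreData.proj.vertexMap v') ⥤ FintypeCat.{v₁})
    (e : (A.coveringHom.φV v').pullback ⋙ F' ≅ F)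
    (t : F'.obj ((Shrink.equivalence (Over ((A.vComp v').1 : 𝒢.V (A.fibreData.proj.vertexMap v')))).functor.obj
      (Over.mk (𝟙 ((A.vComp v').1 : 𝒢.V (A.fibreData.proj.vertexMap v')))))) :
    F.map (A.vComp v').1.arrow (e.hom.app ((A.vComp v').1 : 𝒢.V (A.fibreData.proj.vertexMap v'))
        (F'.map ((Shrink.equivalence (Over ((A.vComp v').1 : 𝒢.V (A.fibreData.proj.vertexMap v')))).functor.map
            ((Over.forgetAdjStar ((A.vComp v').1 : 𝒢.V (A.fibreData.proj.vertexMap v'))).unit.app (Over.mk (𝟙 _))) ≫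
          (Iso.refl (A.coveringHom.φV v').pullback).inv.app _) t)) =
      e.hom.app (A.S (A.fibreData.proj.vertexMap v'))
        (F'.map ((Shrink.equivalence (Over ((A.vComp v').1 : 𝒢.V (A.fibreData.proj.vertexMap v')))).functor.map
          ((Over.forgetAdjStar ((A.vComp v').1 : 𝒢.V (A.fibreData.proj.vertexMap v'))).unit.app (Over.mk (𝟙 _)) ≫
            (Over.star ((A.vComp v').1 : 𝒢.V (A.fibreData.proj.vertexMap v'))).map (A.vComp v').1.arrow)) t) := by
  have hq : ((A.coveringHom.φV v').pullback ⋙ F').map (A.vComp v').1.arrow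
      (F'.map ((Shrink.equivalence (Over ((A.vComp v').1 : 𝒢.V (A.fibreData.proj.vertexMap v')))).functor.map
            ((Over.forgetAdjStar ((A.vComp v').1 : 𝒢.V (A.fibreData.proj.vertexMap v'))).unit.app (Over.mk (𝟙 _))) ≫
          (Iso.refl (A.coveringHom.φV v').pullback).inv.app _) t) =
      F'.map ((Shrink.equivalence (Over ((A.vComp v').1 : 𝒢.V (A.fibreData.proj.vertexMap v')))).functor.map
          ((Over.forgetAdjStar ((A.vComp v').1 : 𝒢.V (A.fibreData.proj.vertexMap v'))).unit.app (Over.mk (𝟙 _)) ≫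
            (Over.star ((A.vComp v').1 : 𝒢.V (A.fibreData.proj.vertexMap v'))).map (A.vComp v').1.arrow)) t := by
    change F'.map ((Shrink.equivalence _).functor.map ((Over.star _).map _)) (F'.map (_ ≫ 𝟙 _) t) = _
    rw [Category.comp_id, ← FintypeCat.comp_apply, ← F'.map_comp, ← Functor.map_comp]
    rfl
  rw [← hq]
  exact (FunctorToFintypeCat.naturality _ _ e.hom _ _).symm

/-- **Vertex alignment (a) for `𝒢_A → 𝒢`**: for a vertex `v′ = (v, P)` and basepoints `F′`, `F` with
`e : φ_{v′}^* ⋙ F′ ≅ F`, the verticial subgroup of `v′` read in `Π_𝒢` equals `Π′ ∩ Π_v`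
(`Π′ = ι(Π_{𝒢_A})`, `Π_v = im(Π_v → Π_𝒢)`): both equal `Stab_Π(a) ∩ Π_v` for the tautological point
`a ∈ F(S_v)` — the local half is L6-t17's `range π₁ = stabiliser` for `(𝒢_v)_P → 𝒢_v`, the global
half is (K′). [cite: MochizukiSemiAnbd2006, Rem. 2.2.1 p.24] -/
theorem coveringHom_vertexAligned_base (v' : A.fibreData.total.Vertex)
    (F' : A.coveringGraph.V v' ⥤ FintypeCat.{v₁}) [FiberFunctor F']
    (F : 𝒢.V (A.fibreData.proj.vertexMap v') ⥤ FintypeCat.{v₁}) [FiberFunctor F]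
    (e : (A.coveringHom.φV v').pullback ⋙ F' ≅ F) :
    (((Aut.autMulEquivOfIso (isoWhiskerLeft (𝒢.ρ (A.fibreData.proj.vertexMap v')) e)).toMonoidHom.comp
        (pi1Map A.coveringHom.pullbackFunctor (A.coveringGraph.ρ v' ⋙ F'))).comp
      (A.coveringGraph.piVToPi v' F')).range =
    ((Aut.autMulEquivOfIso (isoWhiskerLeft (𝒢.ρ (A.fibreData.proj.vertexMap v')) e)).toMonoidHom.comp
        (pi1Map A.coveringHom.pullbackFunctor (A.coveringGraph.ρ v' ⋙ F'))).range ⊓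
      (𝒢.piVToPi (A.fibreData.proj.vertexMap v') F).range := by
  -- notation
  let v := A.fibreData.proj.vertexMap v'
  let P : Subobject (A.S v) := (A.vComp v').1
  let eP := Shrink.equivalence (Over (P : 𝒢.V v))
  haveI : GaloisCategory (Shrink.{u₁} (Over (P : 𝒢.V v))) := A.galoisCategory_vModel v'
  obtain ⟨t⟩ := A.nonempty_fiber_mkId v' F'
  -- the local half: `range (conj_e ∘ π₁(φ_{v′})) = Stab(p)` (L6-t17)
  have hloc := range_pi1Map_eq_stabilizer (S := (P : 𝒢.V v)) eP.functor
    (Q := (A.coveringHom.φV v').pullback) (Iso.refl _) F' e t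
  have hinj : Function.Injective (F.map P.arrow) :=
    ConcreteCategory.injective_of_mono_of_preservesPullback _
  have hfac := A.ι_comp_piVToPi_eq v' F' F e
  have hpt := A.map_arrow_basePoint v' F' F e t
  rw [hfac, MonoidHom.range_comp, hloc,
    map_stabilizer_pi1Map_eq (𝒢.ρ (A.fibreData.proj.vertexMap v')) F (A := A) P.arrow hinj]
  -- it remains: `Stab(a) ⊓ Πv = Π′ ⊓ Πv`
  apply le_antisymm
  · intro g hg
    obtain ⟨hga, hPv⟩ := Subgroup.mem_inf.mp hg
    refine Subgroup.mem_inf.mpr ⟨?_, hPv⟩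
    -- `g ∈ Stab(a) ∩ Πv = piVToPi (Stab p) = image of Π_{v′}`, hence `g ∈ Π′`
    have h1 : g ∈ (MulAction.stabilizer (Aut F) (e.hom.app (P : 𝒢.V v)
        (F'.map (eP.functor.map ((Over.forgetAdjStar (P : 𝒢.V v)).unit.app (Over.mk (𝟙 (P : 𝒢.V v)))) ≫
          (Iso.refl (A.coveringHom.φV v').pullback).inv.app (P : 𝒢.V v)) t))).map
        (𝒢.piVToPi (A.fibreData.proj.vertexMap v') F) := by
      rw [map_stabilizer_pi1Map_eq (𝒢.ρ (A.fibreData.proj.vertexMap v')) F (A := A) P.arrow hinj]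
      exact Subgroup.mem_inf.mpr ⟨hga, hPv⟩
    rw [← hloc, ← MonoidHom.range_comp, ← hfac, MonoidHom.range_comp] at h1
    exact Subgroup.map_le_range _ _ h1
  · intro g hg
    obtain ⟨hg', hPv⟩ := Subgroup.mem_inf.mp hg
    refine Subgroup.mem_inf.mpr ⟨?_, hPv⟩
    have hK := A.range_ι_le_stabilizer v' F' F e t hg'
    rw [← hpt] at hK
    exact hK

/-! ### E. Vertex alignment, clause (b): the other vertices over `v` -/

/-- **Vertex alignment (b) for `𝒢_A → 𝒢`**: for two vertices `v′ = (v, P)` and `v″ = (v, P″)` of `𝒢_A` over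
the same `v`, basepoints `F′`, `F` with `e : φ_{v′}^* ⋙ F′ ≅ F`, a basepoint `F″` of `(𝒢_v)_{P″}` and a
transport `α : ρ′_{v″} ⋙ F″ ≅ ρ′_{v′} ⋙ F′` of basepoints of `B(𝒢_A)`, the verticial subgroup of `v″`
read in `Π_𝒢` through `α` and `ι` is a decomposition group `Π′ ∩ g⁻¹ Π_v g`: with
`F₂ := φ_{v″}^* ⋙ F″`, `β := e ∘ φ^* α : ρ_v ⋙ F₂ ≅ ρ_v ⋙ F` and an isomorphism of basepoints
`γ : F₂ ≅ F` of `𝒢_v`, take `g := β⁻¹ (ρ_v γ)`; the tautological point is carried from `v″` to `v′` by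
`α` (naturality along the diagonal endomorphism). [cite: MochizukiSemiAnbd2006, Rem. 2.2.1 p.24] -/
theorem coveringHom_vertexAligned_conj (v₀ : 𝒢.graph.Vertex) (c₁ c₂ : A.fibreData.FV v₀)
    (F' : A.coveringGraph.V (⟨v₀, c₁⟩ : A.fibreData.total.Vertex) ⥤ FintypeCat.{v₁}) [FiberFunctor F']
    (F : 𝒢.V v₀ ⥤ FintypeCat.{v₁}) [FiberFunctor F]
    (e : (A.coveringHom.φV (⟨v₀, c₁⟩ : A.fibreData.total.Vertex)).pullback ⋙ F' ≅ F)
    (F'' : A.coveringGraph.V (⟨v₀, c₂⟩ : A.fibreData.total.Vertex) ⥤ FintypeCat.{v₁}) [FiberFunctor F'']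
    (α : A.coveringGraph.ρ (⟨v₀, c₂⟩ : A.fibreData.total.Vertex) ⋙ F'' ≅
      A.coveringGraph.ρ (⟨v₀, c₁⟩ : A.fibreData.total.Vertex) ⋙ F') :
    ∃ g : 𝒢.Pi v₀ F,
      (((Aut.autMulEquivOfIso (isoWhiskerLeft (𝒢.ρ v₀) e)).toMonoidHom.comp
          (pi1Map A.coveringHom.pullbackFunctor
            (A.coveringGraph.ρ (⟨v₀, c₁⟩ : A.fibreData.total.Vertex) ⋙ F'))).comp
        ((Aut.autMulEquivOfIso α).toMonoidHom.comp
          (A.coveringGraph.piVToPi (⟨v₀, c₂⟩ : A.fibreData.total.Vertex) F''))).range =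
      ((Aut.autMulEquivOfIso (isoWhiskerLeft (𝒢.ρ v₀) e)).toMonoidHom.comp
          (pi1Map A.coveringHom.pullbackFunctor
            (A.coveringGraph.ρ (⟨v₀, c₁⟩ : A.fibreData.total.Vertex) ⋙ F'))).range ⊓
        ConjAct.toConjAct g⁻¹ • (𝒢.piVToPi v₀ F).range := by
  -- notation
  let v₁ : A.fibreData.total.Vertex := ⟨v₀, c₁⟩
  let v₂ : A.fibreData.total.Vertex := ⟨v₀, c₂⟩
  haveI : GaloisCategory (Shrink.{u₁} (Over ((A.vComp v₂).1 : 𝒢.V (A.fibreData.proj.vertexMap v₂)))) :=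
    A.galoisCategory_vModel v₂
  -- `F₂ := φ_{v″}^* ⋙ F″` is a basepoint of `𝒢_v`
  haveI : PreservesFiniteLimits (A.coveringHom.φV v₂).pullback := (A.coveringHom.φV v₂).property.1
  haveI : PreservesFiniteColimits (A.coveringHom.φV v₂).pullback := (A.coveringHom.φV v₂).property.2
  haveI : FiberFunctor ((A.coveringHom.φV v₂).pullback ⋙ F'') :=
    fiberFunctor_comp_of_exact (A.coveringHom.φV v₂).pullback F''
  obtain ⟨t₁⟩ := A.nonempty_fiber_mkId v₁ F'
  obtain ⟨t₂⟩ := A.nonempty_fiber_mkId v₂ F''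
  obtain ⟨γ⟩ := nonempty_iso_of_fiberFunctor ((A.coveringHom.φV v₂).pullback ⋙ F'') F
  -- `β := e ∘ φ^* α : ρ_v ⋙ F₂ ≅ ρ_v ⋙ F` and `g := β⁻¹ (ρ_v γ)`
  let β : 𝒢.ρ v₀ ⋙ ((A.coveringHom.φV v₂).pullback ⋙ F'') ≅ 𝒢.ρ v₀ ⋙ F :=
    isoWhiskerLeft A.coveringHom.pullbackFunctor α ≪≫ isoWhiskerLeft (𝒢.ρ v₀) e
  obtain ⟨g, hg⟩ := map_range_pi1Map_autMulEquivOfIso (𝒢.ρ v₀) γ β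
  refine ⟨g, ?_⟩
  -- factorisation of the homomorphism through `Aut F₂`
  have hfac : ((Aut.autMulEquivOfIso (isoWhiskerLeft (𝒢.ρ v₀) e)).toMonoidHom.comp
          (pi1Map A.coveringHom.pullbackFunctor (A.coveringGraph.ρ v₁ ⋙ F'))).comp
        ((Aut.autMulEquivOfIso α).toMonoidHom.comp (A.coveringGraph.piVToPi v₂ F'')) =
      ((Aut.autMulEquivOfIso β).toMonoidHom.comp
          (𝒢.piVToPi v₀ ((A.coveringHom.φV v₂).pullback ⋙ F''))).comp
        ((Aut.autMulEquivOfIso (Iso.refl ((A.coveringHom.φV v₂).pullback ⋙ F''))).toMonoidHom.comp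
          (pi1Map (A.coveringHom.φV v₂).pullback F'')) := by
    refine MonoidHom.ext fun x => ?_
    have h1 : pi1Map A.coveringHom.pullbackFunctor (A.coveringGraph.ρ v₂ ⋙ F'')
        (A.coveringGraph.piVToPi v₂ F'' x) =
        𝒢.piVToPi v₀ ((A.coveringHom.φV v₂).pullback ⋙ F'')
          (pi1Map (A.coveringHom.φV v₂).pullback F'' x) :=
      Iso.ext (NatTrans.ext (funext fun X => rfl))
    change Aut.autMulEquivOfIso (isoWhiskerLeft (𝒢.ρ v₀) e)
        (pi1Map A.coveringHom.pullbackFunctor (A.coveringGraph.ρ v₁ ⋙ F')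
          (Aut.autMulEquivOfIso α (A.coveringGraph.piVToPi v₂ F'' x))) =
      Aut.autMulEquivOfIso β (𝒢.piVToPi v₀ ((A.coveringHom.φV v₂).pullback ⋙ F'')
        (Aut.autMulEquivOfIso (Iso.refl ((A.coveringHom.φV v₂).pullback ⋙ F''))
          (pi1Map (A.coveringHom.φV v₂).pullback F'' x)))
    rw [autMulEquivOfIso_refl, ← autMulEquivOfIso_whiskerLeft_pi1Map, h1]
    exact (autMulEquivOfIso_trans _ _ _).symm
  -- the local half at `v″` (L6-t17), with `G := F₂` and `β := refl`
  have hloc₂ := range_pi1Map_eq_stabilizer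
    (S := ((A.vComp v₂).1 : 𝒢.V (A.fibreData.proj.vertexMap v₂)))
    (Shrink.equivalence (Over ((A.vComp v₂).1 : 𝒢.V (A.fibreData.proj.vertexMap v₂)))).functor
    (Q := (A.coveringHom.φV v₂).pullback) (Iso.refl _) F'' (Iso.refl _) t₂
  have hinj₂ : Function.Injective
      (((A.coveringHom.φV v₂).pullback ⋙ F'').map (A.vComp v₂).1.arrow) :=
    ConcreteCategory.injective_of_mono_of_preservesPullback _
  have hpt₂ := A.map_arrow_basePoint v₂ F'' ((A.coveringHom.φV v₂).pullback ⋙ F'') (Iso.refl _) t₂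
  -- the tautological point is carried from `v″` to `v′` by `α` (naturality along the diagonal
  -- endomorphism, which acts as a constant map on both fibres)
  obtain ⟨d, hd⟩ := A.exists_pullbackObj_diagEndo
  have hα := FunctorToFintypeCat.naturality (A.coveringGraph.ρ v₂ ⋙ F'') (A.coveringGraph.ρ v₁ ⋙ F')
    α.hom d
    (F''.map ((Shrink.equivalence (Over ((A.vComp v₂).1 : 𝒢.V (A.fibreData.proj.vertexMap v₂)))).functor.map
      ((Over.forgetAdjStar ((A.vComp v₂).1 : 𝒢.V (A.fibreData.proj.vertexMap v₂))).unit.app (Over.mk (𝟙 _)) ≫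
        (Over.star ((A.vComp v₂).1 : 𝒢.V (A.fibreData.proj.vertexMap v₂))).map (A.vComp v₂).1.arrow)) t₂)
  change α.hom.app (A.coveringHom.pullbackFunctor.obj A) (F''.map (d.fS v₂) _) =
    F'.map (d.fS v₁) (α.hom.app (A.coveringHom.pullbackFunctor.obj A) _) at hα
  rw [A.map_diagEndo_fS_apply d hd v₂ F'' t₂, A.map_diagEndo_fS_apply d hd v₁ F' t₁] at hα
  -- hence the stabilised points agree: `β(F₂(P″ ↪ S_v)(s₀″)) = e(a′)`
  have hb := congrArg (fun y => e.hom.app (A.S v₀) y)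
    ((congrArg (fun y => α.hom.app (A.coveringHom.pullbackFunctor.obj A) y) hpt₂).trans hα)
  -- assemble: the left-hand side is `Stab_Π(b) ⊓ g⁻¹ Π_v g`, and `Π′ ≤ Stab_Π(b)`
  apply le_antisymm
  · refine le_inf ?_ ?_
    · rw [MonoidHom.range_comp]
      exact Subgroup.map_le_range _ _
    · rw [hfac, MonoidHom.range_comp, hloc₂, ← Subgroup.map_map,
        map_stabilizer_pi1Map_eq (𝒢.ρ v₀) ((A.coveringHom.φV v₂).pullback ⋙ F'') (A := A)
          (A.vComp v₂).1.arrow hinj₂,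
        Subgroup.map_inf _ _ (Aut.autMulEquivOfIso β).toMonoidHom (Aut.autMulEquivOfIso β).injective,
        map_stabilizer_autMulEquivOfIso β, hg]
      exact inf_le_right
  · intro x hx
    obtain ⟨hx', hxP⟩ := Subgroup.mem_inf.mp hx
    rw [hfac, MonoidHom.range_comp, hloc₂, ← Subgroup.map_map,
      map_stabilizer_pi1Map_eq (𝒢.ρ v₀) ((A.coveringHom.φV v₂).pullback ⋙ F'') (A := A)
        (A.vComp v₂).1.arrow hinj₂,
      Subgroup.map_inf _ _ (Aut.autMulEquivOfIso β).toMonoidHom (Aut.autMulEquivOfIso β).injective,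
      map_stabilizer_autMulEquivOfIso β, hg]
    refine Subgroup.mem_inf.mpr ⟨?_, hxP⟩
    have hK := MulAction.mem_stabilizer_iff.mp (A.range_ι_le_stabilizer v₁ F' F e t₁ hx')
    exact MulAction.mem_stabilizer_iff.mpr
      (((congrArg (fun y : (𝒢.ρ v₀ ⋙ F).obj A => x • y) hb).trans hK).trans hb.symm)

/-! ### F. The covering `𝒢_A → 𝒢` is vertex aligned -/

/-- **The covering `𝒢_A → 𝒢` defined by a finite étale object `A` of `B(𝒢)` is VERTEX ALIGNED
(Definition 2.2 (i) bookkeeping of [SemiAnbd]):** for every vertex `v′ = (v, P)` of `𝒢_A` and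
basepoints `F′` of `(𝒢_v)_P`, `F` of `𝒢_v` with `e : φ_{v′}^* ⋙ F′ ≅ F`, writing `Π′ = ι(Π_{𝒢_A}) ≤ Π_𝒢`
and `Π_v ≤ Π_𝒢` for the verticial subgroup,
(a) the verticial subgroup of `v′` maps onto `Π′ ∩ Π_v`;
(b) for every vertex `v″ = (v, P″)` over `v` and every transport of basepoints, the verticial subgroup of
`v″` maps onto `Π′ ∩ g⁻¹ Π_v g` for some `g ∈ Π_𝒢`.
Both follow from the tautological `Π_{𝒢_A}`-fixed point of `φ^* A` (the diagonal section of
`P × S_v → P`) and L6-t17's identification of `π₁((𝒢_v)_P) ≤ π₁(𝒢_v)` with a point stabiliser.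
[cite: MochizukiSemiAnbd2006, Def. 2.2 (i) p.23, Rem. 2.2.1 p.24] -/
theorem coveringHom_isVertexAligned : A.coveringHom.IsVertexAligned := by
  intro v' F' _ F _ e
  obtain ⟨v₀, c₁⟩ := v'
  refine ⟨A.coveringHom_vertexAligned_base ⟨v₀, c₁⟩ F' F e, ?_⟩
  intro v'' F'' _ α
  obtain ⟨⟨w, c₂⟩, hw⟩ := v''
  change w = v₀ at hw
  subst hw
  exact A.coveringHom_vertexAligned_conj _ c₁ c₂ F' F e F'' α

/-- **The canonical presentation `coveringHomCan A : 𝒢_A → 𝒢` is vertex aligned** — the same statement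
for abc-iut-L3-t5's twin with the explicit pull-back 2-cells, transported along
`coveringHomCan_eq_coveringHom`. [cite: MochizukiSemiAnbd2006, Def. 2.2 (i) p.23, Rem. 2.2.1 p.24] -/
theorem coveringHomCan_isVertexAligned : A.coveringHomCan.IsVertexAligned := by
  rw [coveringHomCan_eq_coveringHom]
  exact A.coveringHom_isVertexAligned

end BObj

end SemiGraphOfAnabelioids

end Literature.AnabelianGeometry.SemiGraphs
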